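import Summits.Ventures.PercRepro.GenQEightSixBounds
import Summits.Ventures.PercRepro.GenQSolidTriples

/-!
# PercRepro — the `(8, 6)` cell: THE LARGE CORANKS BY COUNTING (night-4, gen 5)

The balance `Jq M G 6 t` of a rank-`6` set `G` of the core (lines `≤ 3`, planes `≤ 6`, solids `≤ 10`, rank-`5`
flats `≤ 21` points) is `≥ 0` for `3 ≤ t ≤ 5` as soon as `|G| ≥ 25` (`|G| ≥ 22` at `t ≤ 4`), with no certificate:
`J_t ≥ Σ_{S ∈ R₆(G)} ((8 − t)/(1 + m(S)) − 8/7)` (the demand-free count is `≥ 0`), and the weight of a rank-`6`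
subset `S` is bounded below by its SIZE — `m(S) ≤ 1` when `|S| ≥ 13` (a cyclic part of rank `6 − m` has `≤ f(6 − m)`
points, `m ≥ 5` forces a basis), `m(S) ≤ 2, 3, 4` when `|S| ≥ 10, 8, 7`; every subset with `≥ 22` points spans; the
non-spanning `j`-subsets (`13 ≤ j ≤ 21`) lie in the rank-`5` flats and number `≤ (C(21, j)/C(21, 11))·C(|G|, 11)`
(every `11`-subset of a rank-`5` flat has rank `5`).  The explicit bound `lbSum t n` (`GenQLargeCorankBound`) is
checked `≥ 0` in `GenQLargeCorankNum.lean`.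

* `card_le_of_eRk_le_core`, `mTr_le_of_card_core`: sizes and coloop counts on the core;
* `mem_Rq_of_card_ge`, `card_filter_Rq_eq_choose`, `choose_le_card_filter_Rq_add`, `sum_flats_five_choose_eleven_le`,
  `choose_ratio_le`, `sum_flats_choose_le`: the spanning and non-spanning counts;
The weights by size and the bound `lbSum t |G| ≤ Jq M G 6 t` are in `GenQLargeCorankBound.lean`.

Imports `GenQEightSixBounds` (`CoreHyps`) and `GenQSolidTriples` (`card_rank_eq_eq_sum_flats`, `card_le_three_of_eRk_le_two'`).
-/namespace PercRepro.Night4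

open Finset ThmH SixFour GenQ PerFlat Star

variable {α : Type} [DecidableEq α] {M : Matroid α} [M.Finite]

/-! ## Sizes of sets of bounded rank on the core -/

omit [DecidableEq α] in
/-- `clF M X` is a rank-`r` flat when `X` has rank `r`. -/
theorem clF_mem_flatsQ {X : Finset α} {r : ℕ} (hr : M.eRk (X : Set α) = (r : ℕ∞)) :
    clF M X ∈ flatsQ M r := by
  rw [mem_flatsQ]
  refine ⟨?_, ?_, ?_⟩
  · intro x hx
    rw [← Finset.mem_coe, coe_clF] at hx
    have := M.closure_subset_ground _ hx
    rw [← coe_gr M] at this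
    exact Finset.mem_coe.1 this
  · rw [coe_clF]
    exact M.isFlat_closure _
  · rw [coe_clF, M.eRk_closure_eq, hr]

omit [DecidableEq α] in
/-- `X ⊆ clF M X` for `X ⊆ gr M`. -/
theorem subset_clF {X : Finset α} (hX : X ⊆ gr M) : X ⊆ clF M X := by
  intro x hx
  rw [← Finset.mem_coe, coe_clF]
  have hXE : (X : Set α) ⊆ M.E := by
    rw [← coe_gr M]
    exact Finset.coe_subset.2 hX
  exact M.subset_closure _ hXE (Finset.mem_coe.2 hx)

omit [DecidableEq α] in
/-- On the core a set of rank `≤ 5` has `≤ 21` points, of rank `≤ 4` `≤ 10` points, of rank `≤ 3` `≤ 6` points. -/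
theorem card_le_of_eRk_le_core (hh : CoreHyps M) {X : Finset α} (hX : X ⊆ gr M) :
    (M.eRk (X : Set α) ≤ 5 → X.card ≤ 21) ∧ (M.eRk (X : Set α) ≤ 4 → X.card ≤ 10) ∧
      (M.eRk (X : Set α) ≤ 3 → X.card ≤ 6) := by
  obtain ⟨hs, hline, hplane, hsolid, hflat5⟩ := hh
  obtain ⟨r, hr⟩ := exists_eRk_eq_nat (M := M) X
  have hr' : ∀ {s : ℕ}, (∀ F ∈ flatsQ M r, F.card ≤ s) → X.card ≤ s := fun hf =>
    (Finset.card_le_card (subset_clF hX)).trans (hf _ (clF_mem_flatsQ hr))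
  have h2 : r ≤ 2 → X.card ≤ 3 := fun h =>
    card_le_three_of_eRk_le_two' hs hline hX (by rw [hr]; exact_mod_cast h)
  refine ⟨fun h5 => ?_, fun h4 => ?_, fun h3 => ?_⟩
  · have : r ≤ 5 := by rw [hr] at h5; exact_mod_cast h5
    rcases (show r ≤ 2 ∨ r = 3 ∨ r = 4 ∨ r = 5 by omega) with h | h | h | h
    · exact (h2 h).trans (by norm_num)
    · subst h; exact (hr' hplane).trans (by norm_num)
    · subst h; exact (hr' hsolid).trans (by norm_num)
    · subst h; exact hr' hflat5
  · have : r ≤ 4 := by rw [hr] at h4; exact_mod_cast h4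
    rcases (show r ≤ 2 ∨ r = 3 ∨ r = 4 by omega) with h | h | h
    · exact (h2 h).trans (by norm_num)
    · subst h; exact (hr' hplane).trans (by norm_num)
    · subst h; exact hr' hsolid
  · have : r ≤ 3 := by rw [hr] at h3; exact_mod_cast h3
    rcases (show r ≤ 2 ∨ r = 3 by omega) with h | h
    · exact (h2 h).trans (by norm_num)
    · subst h; exact hr' hplane

/-- **The coloop count of a rank-`6` subset `S` of a rank-`6` set `G` of the core, by its size**: `m(S) ≤ 6`, and
`|S| ≥ 7, 8, 10, 13` force `m(S) ≤ 4, 3, 2, 1` (a cyclic part of rank `6 − m` has `≤ f(6 − m)` points; `m ≥ 5`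
forces a basis). -/
theorem mTr_le_of_card_core (hh : CoreHyps M) {G S : Finset α} {d : ℕ} (hG : G ⊆ gr M)
    (hcard : G.card = 6 + d) (hS : S ∈ Rq M G 6) :
    mTr M S ≤ 6 ∧ (7 ≤ S.card → mTr M S ≤ 4) ∧ (8 ≤ S.card → mTr M S ≤ 3) ∧
      (10 ≤ S.card → mTr M S ≤ 2) ∧ (13 ≤ S.card → mTr M S ≤ 1) := by
  obtain ⟨hs, hline, hplane, hsolid, hflat5⟩ := hh
  have hS' := mem_Rq.1 hS
  have hSg : S ⊆ gr M := hS'.1.trans hG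
  have hm6 : mTr M S ≤ 6 := mTr_le_of_eRk_eq hSg hS'.2
  have h6 : 6 ≤ S.card := le_card_of_eRk_eq hS'.2
  have hbasis : 5 ≤ mTr M S → S.card = 6 := by
    intro hm
    by_contra hne
    have hsd : (G \ S).card = G.card - S.card := Finset.card_sdiff_of_subset hS'.1
    have hSG : S.card ≤ G.card := Finset.card_le_card hS'.1
    have hk : (G \ S).card < d := by omega
    have h0 := card_Pc_eq_zero_of_nonbasis hs hG (by norm_num) hcard (k := (G \ S).card) (m := mTr M S) hk
      (by omega)
    have hmem : S ∈ Pc M G 6 (G \ S).card (mTr M S) := mem_Pc.2 ⟨hS, rfl, rfl⟩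
    rw [Finset.card_eq_zero] at h0
    exact Finset.notMem_empty _ (h0 ▸ hmem)
  have h1 : mTr M S = 1 → S.card ≤ 22 := fun hm =>
    card_le_mTr_add_of_flats (q := 6) (m := 1) hflat5 hSg hS'.2 hm
  have h2 : mTr M S = 2 → S.card ≤ 12 := fun hm =>
    card_le_mTr_add_of_flats (q := 6) (m := 2) hsolid hSg hS'.2 hm
  have h3 : mTr M S = 3 → S.card ≤ 9 := fun hm =>
    card_le_mTr_add_of_flats (q := 6) (m := 3) hplane hSg hS'.2 hm
  have h4 : mTr M S = 4 → S.card ≤ 7 := fun hm =>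
    card_le_mTr_add_of_flats (q := 6) (m := 4) hline hSg hS'.2 hm
  refine ⟨hm6, fun hc => ?_, fun hc => ?_, fun hc => ?_, fun hc => ?_⟩
  · by_contra h
    have := hbasis (by omega)
    omega
  · by_contra h
    rcases (show mTr M S = 4 ∨ 5 ≤ mTr M S by omega) with h' | h'
    · have := h4 h'; omega
    · have := hbasis h'; omega
  · by_contra h
    rcases (show mTr M S = 3 ∨ mTr M S = 4 ∨ 5 ≤ mTr M S by omega) with h' | h' | h'
    · have := h3 h'; omega
    · have := h4 h'; omega
    · have := hbasis h'; omega
  · by_contra h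
    rcases (show mTr M S = 2 ∨ mTr M S = 3 ∨ mTr M S = 4 ∨ 5 ≤ mTr M S by omega) with h' | h' | h' | h'
    · have := h2 h'; omega
    · have := h3 h'; omega
    · have := h4 h'; omega
    · have := hbasis h'; omega

/-! ## The spanning subsets -/

omit [DecidableEq α] in
/-- Every subset of `G` with `≥ 22` points spans (`G` of rank `6` on the core). -/
theorem mem_Rq_of_card_ge (hh : CoreHyps M) {G T : Finset α} (hG : G ⊆ gr M)
    (hrG : M.eRk (G : Set α) = ((6 : ℕ) : ℕ∞)) (hT : T ⊆ G) (h22 : 22 ≤ T.card) : T ∈ Rq M G 6 := by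
  refine mem_Rq.2 ⟨hT, le_antisymm ?_ ?_⟩
  · rw [← hrG]
    exact M.eRk_mono (Finset.coe_subset.2 hT)
  · by_contra hlt
    rw [not_le] at hlt
    have h5 : M.eRk (T : Set α) ≤ 5 := by
      obtain ⟨r, hr⟩ := exists_eRk_eq_nat (M := M) T
      rw [hr] at hlt ⊢
      have : r < 6 := by exact_mod_cast hlt
      exact_mod_cast (show r ≤ 5 by omega)
    have := (card_le_of_eRk_le_core hh (hT.trans hG)).1 h5
    omega

omit [DecidableEq α] in
/-- The rank-`6` subsets of `G` with `j ≥ 22` points are all its `j`-subsets. -/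
theorem card_filter_Rq_eq_choose (hh : CoreHyps M) {G : Finset α} (hG : G ⊆ gr M)
    (hrG : M.eRk (G : Set α) = ((6 : ℕ) : ℕ∞)) {j : ℕ} (h22 : 22 ≤ j) :
    ((Rq M G 6).filter (fun S : Finset α => S.card = j)).card = G.card.choose j := by
  rw [← Finset.card_powersetCard]
  congr 1
  ext S
  simp only [Finset.mem_filter, Finset.mem_powersetCard]
  constructor
  · rintro ⟨hS, hc⟩
    exact ⟨(mem_Rq.1 hS).1, hc⟩
  · rintro ⟨hS, hc⟩
    exact ⟨mem_Rq_of_card_ge hh hG hrG hS (hc ▸ h22), hc⟩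

omit [DecidableEq α] in
/-- The rank-`6` subsets of `G` with `j` points number at most `C(|G|, j)`. -/
theorem card_filter_Rq_le_choose (G : Finset α) (j : ℕ) :
    ((Rq M G 6).filter (fun S : Finset α => S.card = j)).card ≤ G.card.choose j := by
  rw [← Finset.card_powersetCard]
  apply Finset.card_le_card
  intro S hS
  rw [Finset.mem_filter] at hS
  exact Finset.mem_powersetCard.2 ⟨(mem_Rq.1 hS.1).1, hS.2⟩

omit [DecidableEq α] in
/-- No rank-`6` subset has fewer than `6` points. -/
theorem card_filter_Rq_eq_zero_of_lt (G : Finset α) {j : ℕ} (hj : j < 6) :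
    ((Rq M G 6).filter (fun S : Finset α => S.card = j)).card = 0 := by
  rw [Finset.card_eq_zero, Finset.eq_empty_iff_forall_notMem]
  intro S hS
  rw [Finset.mem_filter] at hS
  have := le_card_of_eRk_eq (mem_Rq.1 hS.1).2
  omega

/-- **For `13 ≤ j`**: `C(|G|, j) ≤ #{S ∈ R₆(G) : |S| = j} + Σ_{F ∈ flatsQ M 5} C(|F ∩ G|, j)` — a non-spanning
`j`-subset has rank exactly `5` and lies in a rank-`5` flat. -/
theorem choose_le_card_filter_Rq_add (hh : CoreHyps M) {G : Finset α} (hG : G ⊆ gr M)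
    (hrG : M.eRk (G : Set α) = ((6 : ℕ) : ℕ∞)) {j : ℕ} (h13 : 13 ≤ j) :
    G.card.choose j ≤ ((Rq M G 6).filter (fun S : Finset α => S.card = j)).card +
      ∑ F ∈ flatsQ M 5, (F ∩ G).card.choose j := by
  have hsplit : G.powersetCard j ⊆ ((Rq M G 6).filter (fun S : Finset α => S.card = j)) ∪
      ((G.powersetCard j).filter (fun A : Finset α => M.eRk (A : Set α) = ((5 : ℕ) : ℕ∞))) := by
    intro A hA
    rw [Finset.mem_union, Finset.mem_filter, Finset.mem_filter]
    have hA' := Finset.mem_powersetCard.1 hA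
    obtain ⟨r, hr⟩ := exists_eRk_eq_nat (M := M) A
    have hr6 : r ≤ 6 := by
      have := M.eRk_mono (Finset.coe_subset.2 hA'.1)
      rw [hrG, hr] at this
      exact_mod_cast this
    rcases (show r = 6 ∨ r = 5 ∨ r ≤ 4 by omega) with h | h | h
    · left
      exact ⟨mem_Rq.2 ⟨hA'.1, by rw [hr, h]⟩, hA'.2⟩
    · right
      exact ⟨hA, by rw [hr, h]⟩
    · exfalso
      have := (card_le_of_eRk_le_core hh (hA'.1.trans hG)).2.1 (by rw [hr]; exact_mod_cast h)
      omega
  calc G.card.choose j = (G.powersetCard j).card := (Finset.card_powersetCard j G).symm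
    _ ≤ (((Rq M G 6).filter (fun S : Finset α => S.card = j)) ∪
        ((G.powersetCard j).filter (fun A : Finset α => M.eRk (A : Set α) = ((5 : ℕ) : ℕ∞)))).card :=
        Finset.card_le_card hsplit
    _ ≤ ((Rq M G 6).filter (fun S : Finset α => S.card = j)).card +
        ((G.powersetCard j).filter (fun A : Finset α => M.eRk (A : Set α) = ((5 : ℕ) : ℕ∞))).card :=
        Finset.card_union_le _ _
    _ ≤ ((Rq M G 6).filter (fun S : Finset α => S.card = j)).card +
        ∑ F ∈ flatsQ M 5, (F ∩ G).card.choose j := by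
        gcongr
        rw [card_rank_eq_eq_sum_flats hG j 5]
        apply Finset.sum_le_sum
        intro F _
        rw [← Finset.card_powersetCard]
        exact Finset.card_filter_le _ _

/-- **`Σ_{F ∈ flatsQ M 5} C(|F ∩ G|, 11) ≤ C(|G|, 11)`**: every `11`-subset of a rank-`5` flat has rank `5`. -/
theorem sum_flats_five_choose_eleven_le (hh : CoreHyps M) {G : Finset α} (hG : G ⊆ gr M) :
    ∑ F ∈ flatsQ M 5, (F ∩ G).card.choose 11 ≤ G.card.choose 11 := by
  calc ∑ F ∈ flatsQ M 5, (F ∩ G).card.choose 11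
      = ∑ F ∈ flatsQ M 5, (((F ∩ G).powersetCard 11).filter
          (fun A : Finset α => M.eRk (A : Set α) = ((5 : ℕ) : ℕ∞))).card := by
        apply Finset.sum_congr rfl
        intro F hF
        rw [← Finset.card_powersetCard]
        congr 1
        symm
        apply Finset.filter_true_of_mem
        intro A hA
        have hA' := Finset.mem_powersetCard.1 hA
        have hF' := mem_flatsQ.1 hF
        have hAg : A ⊆ gr M := hA'.1.trans (Finset.inter_subset_right.trans hG)
        obtain ⟨r, hr⟩ := exists_eRk_eq_nat (M := M) A
        have hr5 : r ≤ 5 := by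
          have := M.eRk_mono (Finset.coe_subset.2 (hA'.1.trans Finset.inter_subset_left))
          rw [hF'.2.2, hr] at this
          exact_mod_cast this
        have hr5' : 5 ≤ r := by
          by_contra hlt
          have := (card_le_of_eRk_le_core hh hAg).2.1 (by rw [hr]; exact_mod_cast (show r ≤ 4 by omega))
          omega
        rw [hr]
        congr 1
        omega
    _ = ((G.powersetCard 11).filter (fun A : Finset α => M.eRk (A : Set α) = ((5 : ℕ) : ℕ∞))).card :=
        (card_rank_eq_eq_sum_flats hG 11 5).symm
    _ ≤ (G.powersetCard 11).card := Finset.card_filter_le _ _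
    _ = G.card.choose 11 := Finset.card_powersetCard 11 G

/-- `C(21, 11)·C(s, j) ≤ C(21, j)·C(s, 11)` for `s ≤ 21` and `13 ≤ j ≤ 21`. -/
theorem choose_ratio_le {s j : ℕ} (hs : s ≤ 21) (h13 : 13 ≤ j) (h21 : j ≤ 21) :
    Nat.choose 21 11 * s.choose j ≤ Nat.choose 21 j * s.choose 11 := by
  interval_cases s <;> interval_cases j <;> decide

/-- **`C(21, 11)·Σ_F C(|F ∩ G|, j) ≤ C(21, j)·C(|G|, 11)`** for `13 ≤ j ≤ 21` (rank-`5` flats have `≤ 21` points). -/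
theorem sum_flats_choose_le (hh : CoreHyps M) {G : Finset α} (hG : G ⊆ gr M) {j : ℕ} (h13 : 13 ≤ j)
    (h21 : j ≤ 21) :
    Nat.choose 21 11 * ∑ F ∈ flatsQ M 5, (F ∩ G).card.choose j ≤ Nat.choose 21 j * G.card.choose 11 := by
  have hflat5 := hh.2.2.2.2
  calc Nat.choose 21 11 * ∑ F ∈ flatsQ M 5, (F ∩ G).card.choose j
      = ∑ F ∈ flatsQ M 5, Nat.choose 21 11 * (F ∩ G).card.choose j := Finset.mul_sum _ _ _
    _ ≤ ∑ F ∈ flatsQ M 5, Nat.choose 21 j * (F ∩ G).card.choose 11 := by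
        apply Finset.sum_le_sum
        intro F hF
        exact choose_ratio_le ((Finset.card_le_card Finset.inter_subset_left).trans (hflat5 F hF)) h13 h21
    _ = Nat.choose 21 j * ∑ F ∈ flatsQ M 5, (F ∩ G).card.choose 11 := (Finset.mul_sum _ _ _).symm
    _ ≤ Nat.choose 21 j * G.card.choose 11 := by
        gcongr
        exact sum_flats_five_choose_eleven_le hh hG

end PercRepro.Night4
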